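import Summits.ValiantsHypothesis.ValiantsHypothesis.Theses.FreeEnergyLift
import Summits.ValiantsHypothesis.ValiantsHypothesis.Theorems.HubHub
import Literature.Computability.AlgebraicComplexity.ValiantConjectureProofs

/-!
# ValiantsHypothesis / FreeEnergyLift — item `Assembly` (stmt-ValiantsHypothesis-5608)

`FreeEnergyLiftTransfer → PermanentFreeEnergyNoQPLift → ValiantsHypothesis`: if the permanent were
a `VP` family over `ℂ`, the transfer `H1` (instantiated at `σ n = Fin n × Fin n`,
`f n = perPoly (Fin n) ℝ≥0`, whose images over `ℝ` and `ℂ` are `perPoly (Fin n) ℝ` and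
`perPoly (Fin n) ℂ` by `map_perPoly`) would give quasi-polynomial exp+psd lifts of the free-energy
epigraphs of `per_n` for every `n`, contradicting `PermanentFreeEnergyNoQPLift`; hence `per` is not a
`VP` family and the hub lemma (`perFamily ∈ VNP`) gives `VP ℂ ≠ VNP ℂ`. HONEST FRAMING:
bookkeeping over OPEN cruxes of a dormant route; nothing here is progress on `VP ≠ VNP`.
-/

-- layout Summits/ValiantsHypothesis/ValiantsHypothesis forces the duplicated namespace component
set_option linter.dupNamespace false

namespace Summit.ValiantsHypothesis.ValiantsHypothesis.Theorems.FreeEnergyLift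

open Literature.Computability.AlgebraicComplexity MvPolynomial

/-- **Item `Assembly` (stmt-ValiantsHypothesis-5608):**
`FreeEnergyLiftTransfer → PermanentFreeEnergyNoQPLift → ValiantsHypothesis`. [folklore] -/
theorem assembly_proof : Theses.FreeEnergyLift.Assembly := by
  unfold Theses.FreeEnergyLift.Assembly Theses.FreeEnergyLift.FreeEnergyLiftTransfer
    Theses.FreeEnergyLift.PermanentFreeEnergyNoQPLift
  intro hT hNo
  refine Summit.ValiantsHypothesis.Hub.valiantsHypothesis_of_not_isVPFamily_per ?_
    (mem_VP_ofFintype_iff_holds _) (perFamily_mem_VNP_holds ℂ)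
  intro hVP
  -- instantiate the transfer at the nonnegative permanent family
  have hmapC : (fun n => MvPolynomial.map ((algebraMap ℝ ℂ).comp NNReal.toRealHom)
      (perPoly (Fin n) NNReal)) = fun n => perPoly (Fin n) ℂ := by
    funext n; exact map_perPoly _
  have hVP' : IsVPFamily (k := ℂ) (fun n => MvPolynomial.map ((algebraMap ℝ ℂ).comp NNReal.toRealHom)
      (perPoly (Fin n) NNReal)) := by rw [hmapC]; exact hVP
  obtain ⟨c, hc⟩ := hT (fun n => Fin n × Fin n) (fun n => perPoly (Fin n) NNReal) hVP'
  obtain ⟨n, hn⟩ := hNo c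
  obtain ⟨k, m, p, A, b, hsize, hlift⟩ := hc n
  have hmapR : MvPolynomial.map NNReal.toRealHom (perPoly (Fin n) NNReal) = perPoly (Fin n) ℝ :=
    map_perPoly _
  rw [hmapR] at hlift
  exact absurd (hn k m p A b hlift) (not_lt.2 hsize)

end Summit.ValiantsHypothesis.ValiantsHypothesis.Theorems.FreeEnergyLift
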